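import Summits.QuantumFields.YangMills.Theorems.UnitScaleTiltProp7Lane2PatchCommutatorRows
import HarnessLib

/-!
# Route `UnitScaleTilt`, crux «MinimiserStabilityRegPr» (stmt-QuantumFields-19200), E′ ∕ (N06) LANE II «DIVERGENCE RECOVERY AT CURVED `W`» — brick (B6-LOC), FILE 2 of 2:
# THE PER-PATCH ROW `h11` — THE LOCAL `H¹` ENERGY `H u := c₀ℓ²·CURL_HS(u) + ‖D*_W u‖²` OF THE GRADIENT COMMUTATOR `u = D_W(Z φ) − ZE(D_W φ)`, LOCALISED — AND THE LOCALISATION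
# HYPOTHESIS DISCHARGED FROM THE PACKAGE'S SUPPORT ROW

Cell `ym3-torus`, width seat `ym3-torus-px11` (gen 7); ★p1 g19 RECIPE-hPatch v2.1 (G); `H` = the lane-II door of record's local energy ([I-2](c), ✓`Prop7Lane2OverlapRows.localEnergy_sum_le_of_overlap`).
THEOREMS ONLY (0 `def`, 0 `sorry`); `--supports stmt-QuantumFields-19200`, count-neutral.  YM₃ on T³ is a ladder rung (R3), not the Clay problem; nothing here claims (B7), (REC), `hN06`, a stub,
the crux, d = 4 or the mass gap.

WHAT IS PROVED (ns `…Theorems.Prop7Lane2PatchCommutatorH1`; hypotheses as in FILE 1: linear `Z`, `ZE` with the (Z2) readings of a real `ζ`, ANY `φ`, finsets `S ⊆ S'` with «`ζ` constant on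
the 2-cell about every `x ∉ S`», «`S'` ∋ `x, x ± e_μ, x + e_μ + e_ν` for `x ∈ S`»):
* §1 ★★ `hs_curl_gradComm_sum_le_local` — the lattice curl energy of `u` summed over ALL plaquettes is paid by the covariant gradient and the mass of `λ` on `S'` ONLY
  (localised twin of ✓`Prop7Lane2GradCommH1.hs_curl_gradComm_sum_le`, same constants `6d·η²a²`, `192d²·η²a²ε²`; the curl vanishes off `S`, `curl_gradComm_eq_zero`);
* §2 ★★★ `localEnergy_gradComm_le_local` — on `RegPr F n K e W`: `H u ≤ 24a²ℓ²·G_{S'} + (18a₂²ℓ⁴ + 1728a²e²)·Φ_{S'}` (localised twin of ✓`….curlHS_add_normSq_DstarL2_gradComm_le`);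
* §3 at the package's radii: `H u ≤ 54·R⁻²·G_{S'} + (648·R⁻⁴ + 3888·e²R⁻²ℓ⁻²)·Φ_{S'}` (`R = L^s`), and under the knit's window `e·R² ≤ 1` (implied by the member's window of record
  `e ≤ (5396·L^{2s})⁻¹`) the budget's slot shape ★★★ `localEnergy_gradComm_le_slot`: `H u ≤ 4536·(R⁻²·G_{S'} + R⁻⁴·Φ_{S'})` — `patch_budget_v2`'s `h11` with `CH = 4536`, NO extra `e²Φ` slot;
* §4 ★ `cellConst_of_support` — the localisation hypothesis of both files from the package's support row (`ζ c y ≠ 0 ⇒ cycdist(y_κ, c_κ) < D` for all `κ`, `D = L^s·ℓ`) for ANY `S`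
  containing the cyclic cube of radius `D + 1` about `c` (one lattice step moves a cyclic coordinate distance by at most one, ✓`Prop7Lane2CyclicHats.dist_add_one_le`).
`G_{S'} := c₀·Σ_{y∈S'}Σ_μ‖toL2⁻¹(D_W φ)⟨y,μ⟩‖_F²`, `Φ_{S'} := c₀·Σ_{y∈S'}‖toL2S⁻¹φ y‖_F²` as in FILE 1.
HONEST SCOPE.  Hilbert∕lattice bookkeeping over landed rows; nothing of `hPatch`∕(B7)∕(REC)∕hN06∕the crux is proved or claimed.

References: T. Bałaban, CMP 99 (1985) 389–434 [Balaban1985BackgroundPropagators] ((3.4) p.391, (3.8)–(3.12) p.392, (3.19) p.393, (3.100) pp.413–414); CMP 102 (1985) 277–309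
[Balaban1985Variational] ((2) p.278, (5) p.278); CMP 96 (1984) 223–250 [Balaban1984PropagatorsII] (p.238).
-/

set_option autoImplicit false

noncomputable section

open scoped BigOperators Matrix.Norms.L2Operator Matrix

namespace Summit.QuantumFields.YangMills.Theorems.Prop7Lane2PatchCommutatorH1


open Literature.MathematicalPhysics.QuantumFieldTheory.Balaban1983to89
open Literature.MathematicalPhysics.QuantumFieldTheory.Balaban1983to89.T3ContinuumYM3Torus
open Literature.MathematicalPhysics.QuantumFieldTheory.Balaban1983to89.T3PrintedRegularMinimiser (RegPr)
open T3SectALandauChart (covDerivFwdT bgUnits eta eta_pos)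
open B10Eq27TorusAxialLog (unitsField toUField)
open B7Prop1Explicit (U1 mem_U1)
open B9Eq39Adjoint (R covD covDstar divB curl)
open B9TorusCalculus (torusT torusT_apply torusT_symm_apply torusT_comm)
open B10StarCount (shift_unshift unshift_shift)
open B11Eq103H1Complex (SiteL2K BondL2K)
open Summit.QuantumFields.YangMills.Theorems.Prop7SectET3Transport (periodsT3)
open Summit.QuantumFields.YangMills.Theorems.Prop7SectET3HilbertLetters (W₂ toL2 toL2S DL2 DstarL2 covLapSite)
open Summit.QuantumFields.YangMills.Theorems.Prop7SecondOrderDict (covDerivFwdT_eq_smul_covD)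
open Summit.QuantumFields.YangMills.Theorems.Prop7LandauDict (DL2_toL2S_eq_covDerivFwdT)
open Summit.QuantumFields.YangMills.Theorems.Prop7DivSliceOfMemberDivSq (norm_sq_DstarL2_toL2_eq inv_eta_sq_eq)
open Summit.QuantumFields.YangMills.Theorems.Prop7LaplaceAFlatLetters (norm_sq_toL2 norm_sq_toL2S)
open Summit.QuantumFields.YangMills.Theorems.Prop7CovariantCoercivity (sum_norm_sq_R hyp_of_specialUnitary)
open Summit.QuantumFields.YangMills.Theorems.Prop7CovAgmonLetters (hs_smul)
open Summit.QuantumFields.YangMills.Theorems.Prop7Lane2CutoffCommutators (coe_bgUnits_mem_unitary DL2_smul_sub_smul_apply DL2_smul_sub_smul_eq_toL2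
  norm_sq_DL2_smul_sub_le covLapSite_comm_apply_eq_zero covLapSite_comm_eq_toL2S norm_sq_covLapSite_comm_le)
open Summit.QuantumFields.YangMills.Theorems.Prop7Lane2GradCommH1 (curl_gradComm_eq hs_curl_gradComm_point_le hs_divB_gradComm_sum_le sum_ite_lt_le_sum
  norm_transport_comm_le_of_regPr)
open Summit.QuantumFields.YangMills.Theorems.Prop7Lane2CyclicHats (dist_add_one_le dist_sub_one_le)
open Literature.MathematicalPhysics.QuantumFieldTheory.Balaban1983to89.T4PlaqDisjointFamilies (shift_injective)
open Finset

open Summit.QuantumFields.YangMills.Theorems.Prop7Lane2PatchCommutatorRows (gradComm_eq_fun sum_comp_le_sum_of_mapsTo sum_pair_count hs_covD_eq_eta_sq_mul one_le_pow_L)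

variable (F : T3Family) (n K : ℕ) (c₀ : ℝ) [Fact (0 < c₀)]

/-! ## §1 ★★ The covariant curl of the gradient commutator, summed over the transition set only -/

section CurlLocal

variable {P : Params} {N : ℕ} [NeZero N] (U : Fin P.d → Site P 0 → (Matrix (Fin N) (Fin N) ℂ)ˣ) (η : ℝ) (ζ : Site P 0 → ℝ) (l : Site P 0 → Matrix (Fin N) (Fin N) ℂ)

omit [NeZero N] in
/-- The curl of the gradient commutator VANISHES at every site whose 2-cell sees a constant `ζ` (`ζ(x+e_μ) = ζ(x)`, `ζ(x+e_μ+e_ν) = ζ(x+e_μ)` for all `μ ν`).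
[cite: Balaban1985BackgroundPropagators, (3.4) p.391, (3.100) pp.413–414] -/
theorem curl_gradComm_eq_zero (x : Site P 0) (hx : ∀ μ : Fin P.d, ζ (x.shift μ) = ζ x ∧ ∀ ν : Fin P.d, ζ ((x.shift μ).shift ν) = ζ (x.shift μ))
    (μ ν : Fin P.d) :
    curl (torusT P 0) U (fun κ z => (η * (ζ (z.shift κ) - ζ z)) • R (U κ z) (l (z.shift κ))) μ ν x = 0 := by
  rw [curl_gradComm_eq]
  simp only [(hx ν).1, (hx μ).1, (hx μ).2 ν, sub_self, mul_zero, zero_smul, add_zero]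

/-- ★★ **THE CURL ENERGY OF THE GRADIENT COMMUTATOR, LOCALISED**: with steps `|ζ(x+e_μ) − ζ(x)| ≤ a`, the plaquette datum `‖U_μ(x)U_ν(x+e_μ) − U_ν(x)U_μ(x+e_ν)‖ ≤ ε`,
`ζ` constant on the 2-cell about every site off `S`, and `S'` containing the one- and two-step forward translates of `S`:
`Σ_xΣ_μΣ_ν hs(curl u (x,μ,ν)) ≤ 6d·η²a²·Σ_{y∈S'}Σ_μ hs(D_μλ y) + 192d²·η²a²ε²·Σ_{y∈S'} hs(λ y)` — the localised twin of ✓`Prop7Lane2GradCommH1.hs_curl_gradComm_sum_le`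
(same constants). [cite: Balaban1985BackgroundPropagators, (3.100) pp.413–414] -/
theorem hs_curl_gradComm_sum_le_local (hUu : ∀ μ x, (U μ x : Matrix (Fin N) (Fin N) ℂ) ∈ unitary (Matrix (Fin N) (Fin N) ℂ))
    (hU1 : ∀ μ x, U μ x ∈ U1 (Matrix (Fin N) (Fin N) ℂ)) {a ε : ℝ} (ha : 0 ≤ a)
    (hstep : ∀ (x : Site P 0) (μ : Fin P.d), |ζ (x.shift μ) - ζ x| ≤ a)
    (hplaq : ∀ (x : Site P 0) (μ ν : Fin P.d), ‖((U μ x * U ν (x.shift μ) : (Matrix (Fin N) (Fin N) ℂ)ˣ) : Matrix (Fin N) (Fin N) ℂ) - (U ν x * U μ (x.shift ν) : (Matrix (Fin N) (Fin N) ℂ)ˣ)‖ ≤ ε)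
    (S S' : Finset (Site P 0)) (hζS : ∀ x : Site P 0, x ∉ S → ∀ μ : Fin P.d, ζ (x.shift μ) = ζ x ∧ ∀ ν : Fin P.d, ζ ((x.shift μ).shift ν) = ζ (x.shift μ))
    (hSS' : ∀ x ∈ S, ∀ μ : Fin P.d, x.shift μ ∈ S' ∧ ∀ ν : Fin P.d, (x.shift μ).shift ν ∈ S') :
    ∑ x : Site P 0, ∑ μ : Fin P.d, ∑ ν : Fin P.d, ∑ j : Fin N, ∑ k : Fin N,
        ‖(curl (torusT P 0) U (fun κ z => (η * (ζ (z.shift κ) - ζ z)) • R (U κ z) (l (z.shift κ))) μ ν x) j k‖ ^ 2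
      ≤ 6 * P.d * (η ^ 2 * a ^ 2) * ∑ y ∈ S', ∑ μ : Fin P.d, ∑ j : Fin N, ∑ k : Fin N, ‖(covD (torusT P 0) U μ l y) j k‖ ^ 2
        + 192 * (P.d : ℝ) ^ 2 * (η ^ 2 * a ^ 2 * ε ^ 2) * ∑ y ∈ S', ∑ j : Fin N, ∑ k : Fin N, ‖l y j k‖ ^ 2 := by
  classical
  -- letters
  set G : Fin P.d → Site P 0 → ℝ := fun μ y => ∑ j : Fin N, ∑ k : Fin N, ‖(covD (torusT P 0) U μ l y) j k‖ ^ 2 with hG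
  set M : Site P 0 → ℝ := fun y => ∑ j : Fin N, ∑ k : Fin N, ‖l y j k‖ ^ 2 with hM
  have hG0 : ∀ μ y, 0 ≤ G μ y := fun μ y => Finset.sum_nonneg fun _ _ => Finset.sum_nonneg fun _ _ => sq_nonneg _
  have hM0 : ∀ y, 0 ≤ M y := fun y => Finset.sum_nonneg fun _ _ => Finset.sum_nonneg fun _ _ => sq_nonneg _
  -- pointwise: either off `S` (zero) or the lineage's pointwise bound
  have hpt : ∀ (x : Site P 0) (μ ν : Fin P.d), ∑ j : Fin N, ∑ k : Fin N,
      ‖(curl (torusT P 0) U (fun κ z => (η * (ζ (z.shift κ) - ζ z)) • R (U κ z) (l (z.shift κ))) μ ν x) j k‖ ^ 2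
      ≤ if x ∈ S then 3 * η ^ 2 * a ^ 2 * (G μ (x.shift ν) + G ν (x.shift μ)) + 192 * η ^ 2 * a ^ 2 * ε ^ 2 * M ((x.shift μ).shift ν) else 0 := by
    intro x μ ν
    by_cases hx : x ∈ S
    · rw [if_pos hx]
      exact hs_curl_gradComm_point_le U η ζ l hUu hU1 ha hstep hplaq x μ ν
    · rw [if_neg hx, curl_gradComm_eq_zero U η ζ l x (hζS x hx) μ ν]
      simp
  have h1 := Finset.sum_le_sum fun x (_ : x ∈ (Finset.univ : Finset (Site P 0))) =>
    Finset.sum_le_sum fun μ (_ : μ ∈ (Finset.univ : Finset (Fin P.d))) => Finset.sum_le_sum fun ν (_ : ν ∈ (Finset.univ : Finset (Fin P.d))) => hpt x μ ν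
  refine h1.trans ?_
  -- restrict to `S`
  have hS : ∑ x : Site P 0, ∑ μ : Fin P.d, ∑ ν : Fin P.d,
      (if x ∈ S then 3 * η ^ 2 * a ^ 2 * (G μ (x.shift ν) + G ν (x.shift μ)) + 192 * η ^ 2 * a ^ 2 * ε ^ 2 * M ((x.shift μ).shift ν) else 0)
      = ∑ x ∈ S, ∑ μ : Fin P.d, ∑ ν : Fin P.d, (3 * η ^ 2 * a ^ 2 * (G μ (x.shift ν) + G ν (x.shift μ)) + 192 * η ^ 2 * a ^ 2 * ε ^ 2 * M ((x.shift μ).shift ν)) := by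
    have hx : ∀ x : Site P 0, (∑ μ : Fin P.d, ∑ ν : Fin P.d,
        (if x ∈ S then 3 * η ^ 2 * a ^ 2 * (G μ (x.shift ν) + G ν (x.shift μ)) + 192 * η ^ 2 * a ^ 2 * ε ^ 2 * M ((x.shift μ).shift ν) else 0))
        = if x ∈ S then ∑ μ : Fin P.d, ∑ ν : Fin P.d, (3 * η ^ 2 * a ^ 2 * (G μ (x.shift ν) + G ν (x.shift μ)) + 192 * η ^ 2 * a ^ 2 * ε ^ 2 * M ((x.shift μ).shift ν))
          else 0 := by
      intro x
      split_ifs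
      · rfl
      · simp
    rw [Finset.sum_congr rfl fun x _ => hx x, Finset.sum_ite_mem, Finset.univ_inter]
  rw [hS]
  -- the three shifted sums sit inside the `S'` sums
  have hA : ∀ μ ν : Fin P.d, ∑ x ∈ S, G μ (x.shift ν) ≤ ∑ y ∈ S', G μ y := fun μ ν =>
    sum_comp_le_sum_of_mapsTo S S' (fun x => x.shift ν) (shift_injective (P := P) (j := 0) ν) (fun x hx => (hSS' x hx ν).1) (G μ) (hG0 μ)
  have hB : ∀ μ ν : Fin P.d, ∑ x ∈ S, G ν (x.shift μ) ≤ ∑ y ∈ S', G ν y := fun μ ν =>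
    sum_comp_le_sum_of_mapsTo S S' (fun x => x.shift μ) (shift_injective (P := P) (j := 0) μ) (fun x hx => (hSS' x hx μ).1) (G ν) (hG0 ν)
  have hC : ∀ μ ν : Fin P.d, ∑ x ∈ S, M ((x.shift μ).shift ν) ≤ ∑ y ∈ S', M y := fun μ ν =>
    sum_comp_le_sum_of_mapsTo S S' (fun x => (x.shift μ).shift ν) ((shift_injective (P := P) (j := 0) ν).comp (shift_injective (P := P) (j := 0) μ))
      (fun x hx => (hSS' x hx μ).2 ν) M hM0
  -- bookkeeping: move `Σ_{x∈S}` inside, bound each piece, count the direction pairs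
  have hswap : ∑ x ∈ S, ∑ μ : Fin P.d, ∑ ν : Fin P.d, (3 * η ^ 2 * a ^ 2 * (G μ (x.shift ν) + G ν (x.shift μ)) + 192 * η ^ 2 * a ^ 2 * ε ^ 2 * M ((x.shift μ).shift ν))
      = ∑ μ : Fin P.d, ∑ ν : Fin P.d, (3 * η ^ 2 * a ^ 2 * (∑ x ∈ S, G μ (x.shift ν) + ∑ x ∈ S, G ν (x.shift μ))
          + 192 * η ^ 2 * a ^ 2 * ε ^ 2 * ∑ x ∈ S, M ((x.shift μ).shift ν)) := by
    rw [Finset.sum_comm]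
    refine Finset.sum_congr rfl fun μ _ => ?_
    rw [Finset.sum_comm]
    refine Finset.sum_congr rfl fun ν _ => ?_
    rw [Finset.sum_add_distrib, ← Finset.mul_sum, ← Finset.mul_sum, Finset.sum_add_distrib]
  rw [hswap]
  have hpair : ∀ μ ν : Fin P.d, 3 * η ^ 2 * a ^ 2 * (∑ x ∈ S, G μ (x.shift ν) + ∑ x ∈ S, G ν (x.shift μ)) + 192 * η ^ 2 * a ^ 2 * ε ^ 2 * ∑ x ∈ S, M ((x.shift μ).shift ν)
      ≤ 3 * η ^ 2 * a ^ 2 * (∑ y ∈ S', G μ y + ∑ y ∈ S', G ν y) + 192 * η ^ 2 * a ^ 2 * ε ^ 2 * ∑ y ∈ S', M y := by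
    intro μ ν
    have h3 : 0 ≤ 3 * η ^ 2 * a ^ 2 := by positivity
    have h4 : 0 ≤ 192 * η ^ 2 * a ^ 2 * ε ^ 2 := by positivity
    exact add_le_add (mul_le_mul_of_nonneg_left (add_le_add (hA μ ν) (hB μ ν)) h3) (mul_le_mul_of_nonneg_left (hC μ ν) h4)
  refine (Finset.sum_le_sum fun μ _ => Finset.sum_le_sum fun ν _ => hpair μ ν).trans (le_of_eq ?_)
  -- count: `Σ_μΣ_ν (A μ + A ν) = 2d·Σ_μ A μ`, `Σ_μΣ_ν 1 = d²`
  have hGsum : ∑ y ∈ S', ∑ μ : Fin P.d, G μ y = ∑ μ : Fin P.d, ∑ y ∈ S', G μ y := Finset.sum_comm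
  have hcount := sum_pair_count (ι := Fin P.d) (fun μ => ∑ y ∈ S', G μ y) (3 * η ^ 2 * a ^ 2) (192 * η ^ 2 * a ^ 2 * ε ^ 2 * ∑ y ∈ S', M y)
  simp only [Fintype.card_fin] at hcount
  rw [hcount, hGsum]
  ring

end CurlLocal

/-! ## §2 ★★★ (h11-loc) — the local `H¹` energy `H u := c₀ℓ²·CURL_HS(u) + ‖D*_W u‖²` of the gradient commutator, localised -/

section H1Row

variable {e : ℝ} {W : GaugeField (F.P K) 0 (Matrix.specialUnitaryGroup (Fin 2) ℂ)}
  (Z : SiteL2K ℂ 3 (periodsT3 F K) c₀ W₂ →ₗ[ℂ] SiteL2K ℂ 3 (periodsT3 F K) c₀ W₂)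
  (ZE : BondL2K ℂ 3 (periodsT3 F K) c₀ W₂ →ₗ[ℂ] BondL2K ℂ 3 (periodsT3 F K) c₀ W₂) (ζ : Site (F.P K) 0 → ℝ)

/-- ★★★ **(h11-loc)**: on `RegPr F n K e W` (`0 < e`), with steps `|ζ(x±e_μ) − ζ(x)| ≤ a`, second differences `≤ a₂`, `ζ` constant on the 2-cell about every site off `S`,
and `S'` ⊇ `S` and its one- and two-step translates, for EVERY `φ` and `u := D_W(Z φ) − ZE(D_W φ)`:
`c₀ℓ²·CURL^{μ<ν}_HS(u) + ‖D*_W u‖² ≤ 24a²ℓ²·(c₀Σ_{y∈S'}Σ_μ‖toL2⁻¹(D_Wφ)⟨y,μ⟩‖_F²) + (18a₂²ℓ⁴ + 1728a²e²)·(c₀Σ_{y∈S'}‖toL2S⁻¹φ y‖_F²)` — the `H` of the lane-II door of record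
(✓`Prop7Lane2OverlapRows.localEnergy_sum_le_of_overlap`, [I-2](c)); the localised twin of ✓`Prop7Lane2GradCommH1.curlHS_add_normSq_DstarL2_gradComm_le` (same constants).
[cite: Balaban1985BackgroundPropagators, (3.4) p.391, (3.8)–(3.11) p.392, (3.100) pp.413–414; Balaban1985Variational, (2) p.278] -/
theorem localEnergy_gradComm_le_local (he : 0 < e) (hW : RegPr F n K e W)
    (hZ : ∀ φ x, (toL2S F K c₀).symm (Z φ) x = ζ x • (toL2S F K c₀).symm φ x) (hZE : ∀ f b, (toL2 F K c₀).symm (ZE f) b = ζ b.src • (toL2 F K c₀).symm f b)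
    {a a₂ : ℝ} (ha : 0 ≤ a) (S S' : Finset (Site (F.P K) 0))
    (hζ1 : ∀ (x : Site (F.P K) 0) (μ : Fin 3), |ζ (x.shift μ) - ζ x| ≤ a ∧ |ζ (x.unshift μ) - ζ x| ≤ a)
    (hζ2 : ∀ (x : Site (F.P K) 0) (μ : Fin 3), |ζ (x.shift μ) + ζ (x.unshift μ) - 2 * ζ x| ≤ a₂)
    (hζS : ∀ x : Site (F.P K) 0, x ∉ S → ∀ μ : Fin 3, ζ (x.shift μ) = ζ x ∧ ζ (x.unshift μ) = ζ x ∧ ∀ ν : Fin 3, ζ ((x.shift μ).shift ν) = ζ (x.shift μ))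
    (hSS' : ∀ x ∈ S, x ∈ S' ∧ ∀ μ : Fin 3, x.shift μ ∈ S' ∧ x.unshift μ ∈ S' ∧ ∀ ν : Fin 3, (x.shift μ).shift ν ∈ S')
    (φ : SiteL2K ℂ 3 (periodsT3 F K) c₀ W₂) :
    c₀ * ((F.L : ℝ) ^ (K - n)) ^ 2 * (∑ x : Site (F.P K) 0, ∑ μ : Fin (F.P K).d, ∑ ν' : Fin (F.P K).d,
        (if μ < ν' then ∑ j : Fin 2, ∑ k : Fin 2,
          ‖(curl (torusT (F.P K) 0) (fun κ z => unitsField (toUField W) ⟨z, κ⟩)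
            (fun κ z => (toL2 F K c₀).symm (DL2 F n K c₀ W (Z φ) - ZE (DL2 F n K c₀ W φ)) ⟨z, κ⟩) μ ν' x) j k‖ ^ 2 else 0))
      + ‖DstarL2 F n K c₀ W (DL2 F n K c₀ W (Z φ) - ZE (DL2 F n K c₀ W φ))‖ ^ 2
    ≤ 24 * a ^ 2 * ((F.L : ℝ) ^ (K - n)) ^ 2 *
          (c₀ * ∑ y ∈ S', ∑ μ : Fin (F.P K).d, ∑ j : Fin 2, ∑ k : Fin 2, ‖((toL2 F K c₀).symm (DL2 F n K c₀ W φ) ⟨y, μ⟩) j k‖ ^ 2)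
      + (18 * a₂ ^ 2 * ((F.L : ℝ) ^ (K - n)) ^ 4 + 1728 * a ^ 2 * e ^ 2) *
          (c₀ * ∑ y ∈ S', ∑ j : Fin 2, ∑ k : Fin 2, ‖((toL2S F K c₀).symm φ y) j k‖ ^ 2) := by
  classical
  have hη := eta_pos F n K
  have hc₀ : (0 : ℝ) < c₀ := Fact.out
  have hηL : (eta F n K)⁻¹ = (F.L : ℝ) ^ (K - n) := by rw [T3SectALandauChart.eta, ← inv_pow, inv_inv]
  have hℓη : (F.L : ℝ) ^ (K - n) * eta F n K = 1 := by rw [← hηL, inv_mul_cancel₀ hη.ne']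
  have hk : 0 ≤ c₀ * ((F.L : ℝ) ^ (K - n)) ^ 2 := by positivity
  have hUf : (fun (κ : Fin (F.P K).d) (z : Site (F.P K) 0) => bgUnits F K W ⟨z, κ⟩) = fun κ z => unitsField (toUField W) ⟨z, κ⟩ := rfl
  -- the lattice data of `RegPr`
  have hW2 := hyp_of_specialUnitary W fun p => (hW.plaqSmall p).le
  have hUu : ∀ (μ : Fin (F.P K).d) (x : Site (F.P K) 0),
      ((bgUnits F K W ⟨x, μ⟩ : (Matrix (Fin 2) (Fin 2) ℂ)ˣ) : Matrix (Fin 2) (Fin 2) ℂ) ∈ unitary (Matrix (Fin 2) (Fin 2) ℂ) :=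
    fun μ x => coe_bgUnits_mem_unitary F K W μ x
  have hU1 : ∀ (μ : Fin (F.P K).d) (x : Site (F.P K) 0), bgUnits F K W ⟨x, μ⟩ ∈ U1 (Matrix (Fin 2) (Fin 2) ℂ) := fun μ x => hW2.1 ⟨x, μ⟩
  have hplaq := fun (x : Site (F.P K) 0) (μ ν : Fin (F.P K).d) => norm_transport_comm_le_of_regPr F n K he.le hW x μ ν
  -- letters
  set Y : PBond (F.P K) 0 → ℝ := fun b => ∑ j : Fin 2, ∑ k : Fin 2, ‖((toL2 F K c₀).symm (DL2 F n K c₀ W φ) b) j k‖ ^ 2 with hY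
  set M : Site (F.P K) 0 → ℝ := fun x => ∑ j : Fin 2, ∑ k : Fin 2, ‖((toL2S F K c₀).symm φ x) j k‖ ^ 2 with hM
  have hY0 : ∀ b, 0 ≤ Y b := fun b => Finset.sum_nonneg fun _ _ => Finset.sum_nonneg fun _ _ => sq_nonneg _
  have hM0 : ∀ x, 0 ≤ M x := fun x => Finset.sum_nonneg fun _ _ => Finset.sum_nonneg fun _ _ => sq_nonneg _
  -- the two localised lattice rows (in the `ℓ = η⁻¹` letter)
  have hcurl := hs_curl_gradComm_sum_le_local (P := F.P K) (fun κ z => bgUnits F K W ⟨z, κ⟩) ((F.L : ℝ) ^ (K - n)) ζ ((toL2S F K c₀).symm φ) hUu hU1 ha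
    (fun x μ => (hζ1 x μ).1) hplaq S S' (fun x hx μ => ⟨(hζS x hx μ).1, (hζS x hx μ).2.2⟩) (fun x hx μ => ⟨((hSS' x hx).2 μ).1, ((hSS' x hx).2 μ).2.2⟩)
  have hdiv := hs_divB_gradComm_sum_le F K (fun κ z => bgUnits F K W ⟨z, κ⟩) ((F.L : ℝ) ^ (K - n)) ζ ((toL2S F K c₀).symm φ) S hζ1 hζ2
    (fun x hx μ => ⟨(hζS x hx μ).1, (hζS x hx μ).2.1⟩)
  beta_reduce at hcurl hdiv
  have hd : ((F.P K).d : ℝ) = 3 := by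
    show ((3 : ℕ) : ℝ) = 3
    norm_num
  rw [hd] at hcurl
  -- conversions to the `Y`, `M` letters
  have hconv : ∀ (T : Finset (Site (F.P K) 0)), ∑ y ∈ T, ∑ μ : Fin (F.P K).d, ∑ j : Fin 2, ∑ k : Fin 2,
      ‖(covD (torusT (F.P K) 0) (fun μ z => bgUnits F K W ⟨z, μ⟩) μ ((toL2S F K c₀).symm φ) y) j k‖ ^ 2 = (eta F n K) ^ 2 * ∑ y ∈ T, ∑ μ : Fin (F.P K).d, Y ⟨y, μ⟩ := by
    intro T
    rw [Finset.mul_sum]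
    refine Finset.sum_congr rfl fun y _ => ?_
    rw [Finset.mul_sum]
    exact Finset.sum_congr rfl fun μ _ => hs_covD_eq_eta_sq_mul F n K c₀ W φ y μ
  rw [hconv S'] at hcurl
  rw [hconv S] at hdiv
  have hGmono : ∑ x ∈ S, ∑ μ : Fin (F.P K).d, Y ⟨x, μ⟩ ≤ ∑ y ∈ S', ∑ μ : Fin (F.P K).d, Y ⟨y, μ⟩ :=
    Finset.sum_le_sum_of_subset_of_nonneg (fun x hx => (hSS' x hx).1) fun y _ _ => Finset.sum_nonneg fun μ _ => hY0 _
  have hMmono : ∑ x ∈ S, M x ≤ ∑ y ∈ S', M y := Finset.sum_le_sum_of_subset_of_nonneg (fun x hx => (hSS' x hx).1) fun y _ _ => hM0 y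
  have hdiv' : ∑ x : Site (F.P K) 0, ∑ j : Fin 2, ∑ k' : Fin 2,
      ‖(divB (torusT (F.P K) 0) (fun κ z => bgUnits F K W ⟨z, κ⟩)
          (fun κ z => ((F.L : ℝ) ^ (K - n) * (ζ (z.shift κ) - ζ z)) • R (bgUnits F K W ⟨z, κ⟩) ((toL2S F K c₀).symm φ (z.shift κ))) x) j k'‖ ^ 2
      ≤ 6 * ((F.L : ℝ) ^ (K - n)) ^ 2 * (3 * a₂ ^ 2 * ∑ y ∈ S', M y + a ^ 2 * ((eta F n K) ^ 2 * ∑ y ∈ S', ∑ μ : Fin (F.P K).d, Y ⟨y, μ⟩)) := by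
    refine hdiv.trans (mul_le_mul_of_nonneg_left (add_le_add (mul_le_mul_of_nonneg_left hMmono (by positivity))
      (mul_le_mul_of_nonneg_left (mul_le_mul_of_nonneg_left hGmono (sq_nonneg _)) (sq_nonneg _))) (by positivity))
  have hite := sum_ite_lt_le_sum (fun (x : Site (F.P K) 0) (μ ν : Fin (F.P K).d) => ∑ j : Fin 2, ∑ k : Fin 2,
      ‖(curl (torusT (F.P K) 0) (fun κ z => bgUnits F K W ⟨z, κ⟩)
        (fun κ z => ((F.L : ℝ) ^ (K - n) * (ζ (z.shift κ) - ζ z)) • R (bgUnits F K W ⟨z, κ⟩) ((toL2S F K c₀).symm φ (z.shift κ))) μ ν x) j k‖ ^ 2)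
    (fun _ _ _ => by positivity)
  beta_reduce at hite
  -- the goal in lattice letters
  rw [gradComm_eq_fun F n K c₀ Z ZE ζ hZ hZE W φ, DL2_smul_sub_smul_eq_toL2 F n K c₀ W ζ ((toL2S F K c₀).symm φ), LinearEquiv.symm_apply_apply,
    norm_sq_DstarL2_toL2_eq F n K c₀ W, ← hUf, hηL]
  simp only [PBond.tgt]
  refine le_trans (add_le_add (mul_le_mul_of_nonneg_left (hite.trans hcurl) hk) (mul_le_mul_of_nonneg_left hdiv' hk)) (le_of_eq ?_)
  have h2 : ((F.L : ℝ) ^ (K - n)) ^ 2 * (eta F n K) ^ 2 = 1 := by rw [← mul_pow, hℓη, one_pow]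
  linear_combination ((24 * a ^ 2 * ((F.L : ℝ) ^ (K - n)) ^ 2 * (c₀ * ∑ y ∈ S', ∑ μ : Fin (F.P K).d, Y ⟨y, μ⟩))
      + 1728 * a ^ 2 * e ^ 2 * (c₀ * ∑ y ∈ S', M y) * (((F.L : ℝ) ^ (K - n)) ^ 2 * (eta F n K) ^ 2 + 1)) * h2

end H1Row

/-! ## §3 At the package's radii: ABSOLUTE numerals and the budget's slot shape for `h11` -/

section Member

variable {e : ℝ} (W : GaugeField (F.P K) 0 (Matrix.specialUnitaryGroup (Fin 2) ℂ))
  (Z : SiteL2K ℂ 3 (periodsT3 F K) c₀ W₂ →ₗ[ℂ] SiteL2K ℂ 3 (periodsT3 F K) c₀ W₂)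
  (ZE : BondL2K ℂ 3 (periodsT3 F K) c₀ W₂ →ₗ[ℂ] BondL2K ℂ 3 (periodsT3 F K) c₀ W₂) (ζ : Site (F.P K) 0 → ℝ) (s : ℕ)

/-- ★★★ **(h11) AT THE PACKAGE'S RADII**, on `RegPr F n K e W`:
`H(D_W(Z φ) − ZE(D_W φ)) ≤ 54·(L^s)⁻²·G_{S'} + (648·(L^s)⁻⁴ + 3888·e²·(L^s)⁻²·ℓ⁻²)·Φ_{S'}`, `H u := c₀ℓ²·CURL^{μ<ν}_HS(u) + ‖D*_W u‖²`.
[cite: Balaban1985BackgroundPropagators, (3.4) p.391, (3.8)–(3.11) p.392, (3.100) pp.413–414; Balaban1985Variational, (2) p.278] -/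
theorem localEnergy_gradComm_le_member (he : 0 < e) (hW : RegPr F n K e W)
    (hZ : ∀ φ x, (toL2S F K c₀).symm (Z φ) x = ζ x • (toL2S F K c₀).symm φ x) (hZE : ∀ f b, (toL2 F K c₀).symm (ZE f) b = ζ b.src • (toL2 F K c₀).symm f b)
    (S S' : Finset (Site (F.P K) 0))
    (hζ1 : ∀ (x : Site (F.P K) 0) (μ : Fin 3), |ζ (x.shift μ) - ζ x| ≤ 3 / 2 / ((F.L : ℝ) ^ s * (F.L : ℝ) ^ (K - n)) ∧
      |ζ (x.unshift μ) - ζ x| ≤ 3 / 2 / ((F.L : ℝ) ^ s * (F.L : ℝ) ^ (K - n)))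
    (hζ2 : ∀ (x : Site (F.P K) 0) (μ : Fin 3), |ζ (x.shift μ) + ζ (x.unshift μ) - 2 * ζ x| ≤ 6 / ((F.L : ℝ) ^ s * (F.L : ℝ) ^ (K - n)) ^ 2)
    (hζS : ∀ x : Site (F.P K) 0, x ∉ S → ∀ μ : Fin 3, ζ (x.shift μ) = ζ x ∧ ζ (x.unshift μ) = ζ x ∧ ∀ ν : Fin 3, ζ ((x.shift μ).shift ν) = ζ (x.shift μ))
    (hSS' : ∀ x ∈ S, x ∈ S' ∧ ∀ μ : Fin 3, x.shift μ ∈ S' ∧ x.unshift μ ∈ S' ∧ ∀ ν : Fin 3, (x.shift μ).shift ν ∈ S')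
    (φ : SiteL2K ℂ 3 (periodsT3 F K) c₀ W₂) :
    c₀ * ((F.L : ℝ) ^ (K - n)) ^ 2 * (∑ x : Site (F.P K) 0, ∑ μ : Fin (F.P K).d, ∑ ν' : Fin (F.P K).d,
        (if μ < ν' then ∑ j : Fin 2, ∑ k : Fin 2,
          ‖(curl (torusT (F.P K) 0) (fun κ z => unitsField (toUField W) ⟨z, κ⟩)
            (fun κ z => (toL2 F K c₀).symm (DL2 F n K c₀ W (Z φ) - ZE (DL2 F n K c₀ W φ)) ⟨z, κ⟩) μ ν' x) j k‖ ^ 2 else 0))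
      + ‖DstarL2 F n K c₀ W (DL2 F n K c₀ W (Z φ) - ZE (DL2 F n K c₀ W φ))‖ ^ 2
    ≤ 54 * ((F.L : ℝ) ^ s)⁻¹ ^ 2 *
          (c₀ * ∑ y ∈ S', ∑ μ : Fin (F.P K).d, ∑ j : Fin 2, ∑ k : Fin 2, ‖((toL2 F K c₀).symm (DL2 F n K c₀ W φ) ⟨y, μ⟩) j k‖ ^ 2)
      + (648 * ((F.L : ℝ) ^ s)⁻¹ ^ 4 + 3888 * e ^ 2 * ((F.L : ℝ) ^ s)⁻¹ ^ 2 * ((F.L : ℝ) ^ (K - n))⁻¹ ^ 2) *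
          (c₀ * ∑ y ∈ S', ∑ j : Fin 2, ∑ k : Fin 2, ‖((toL2S F K c₀).symm φ y) j k‖ ^ 2) := by
  have h := localEnergy_gradComm_le_local F n K c₀ Z ZE ζ he hW hZ hZE (by positivity) S S' hζ1 hζ2 hζS hSS' φ
  refine h.trans (le_of_eq ?_)
  have hR : (0 : ℝ) < (F.L : ℝ) ^ s := by linarith [one_le_pow_L F s]
  have hℓ : (0 : ℝ) < (F.L : ℝ) ^ (K - n) := by linarith [one_le_pow_L F (K - n)]
  field_simp
  ring

/-- ★★★ **(h11) IN THE BUDGET'S SLOT SHAPE** `HM ≤ CH·(R⁻²·G + R⁻⁴·Φ)` with `CH = 4536`, `R = L^s`, under the knit's window `e·R² ≤ 1` (the member's window of record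
`e ≤ (5396·L^{2s})⁻¹` implies it): the `e²R⁻²ℓ⁻²` term of `localEnergy_gradComm_le_member` is absorbed (`e² ≤ R⁻⁴`, `ℓ⁻² ≤ 1`, `R⁻² ≤ 1`).
[cite: Balaban1985BackgroundPropagators, (3.4) p.391, (3.100) pp.413–414; Balaban1985Variational, (2) p.278] -/
theorem localEnergy_gradComm_le_slot (he : 0 < e) (hW : RegPr F n K e W) (hew : e * ((F.L : ℝ) ^ s) ^ 2 ≤ 1)
    (hZ : ∀ φ x, (toL2S F K c₀).symm (Z φ) x = ζ x • (toL2S F K c₀).symm φ x) (hZE : ∀ f b, (toL2 F K c₀).symm (ZE f) b = ζ b.src • (toL2 F K c₀).symm f b)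
    (S S' : Finset (Site (F.P K) 0))
    (hζ1 : ∀ (x : Site (F.P K) 0) (μ : Fin 3), |ζ (x.shift μ) - ζ x| ≤ 3 / 2 / ((F.L : ℝ) ^ s * (F.L : ℝ) ^ (K - n)) ∧
      |ζ (x.unshift μ) - ζ x| ≤ 3 / 2 / ((F.L : ℝ) ^ s * (F.L : ℝ) ^ (K - n)))
    (hζ2 : ∀ (x : Site (F.P K) 0) (μ : Fin 3), |ζ (x.shift μ) + ζ (x.unshift μ) - 2 * ζ x| ≤ 6 / ((F.L : ℝ) ^ s * (F.L : ℝ) ^ (K - n)) ^ 2)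
    (hζS : ∀ x : Site (F.P K) 0, x ∉ S → ∀ μ : Fin 3, ζ (x.shift μ) = ζ x ∧ ζ (x.unshift μ) = ζ x ∧ ∀ ν : Fin 3, ζ ((x.shift μ).shift ν) = ζ (x.shift μ))
    (hSS' : ∀ x ∈ S, x ∈ S' ∧ ∀ μ : Fin 3, x.shift μ ∈ S' ∧ x.unshift μ ∈ S' ∧ ∀ ν : Fin 3, (x.shift μ).shift ν ∈ S')
    (φ : SiteL2K ℂ 3 (periodsT3 F K) c₀ W₂) :
    c₀ * ((F.L : ℝ) ^ (K - n)) ^ 2 * (∑ x : Site (F.P K) 0, ∑ μ : Fin (F.P K).d, ∑ ν' : Fin (F.P K).d,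
        (if μ < ν' then ∑ j : Fin 2, ∑ k : Fin 2,
          ‖(curl (torusT (F.P K) 0) (fun κ z => unitsField (toUField W) ⟨z, κ⟩)
            (fun κ z => (toL2 F K c₀).symm (DL2 F n K c₀ W (Z φ) - ZE (DL2 F n K c₀ W φ)) ⟨z, κ⟩) μ ν' x) j k‖ ^ 2 else 0))
      + ‖DstarL2 F n K c₀ W (DL2 F n K c₀ W (Z φ) - ZE (DL2 F n K c₀ W φ))‖ ^ 2
    ≤ 4536 * (((F.L : ℝ) ^ s)⁻¹ ^ 2 *
            (c₀ * ∑ y ∈ S', ∑ μ : Fin (F.P K).d, ∑ j : Fin 2, ∑ k : Fin 2, ‖((toL2 F K c₀).symm (DL2 F n K c₀ W φ) ⟨y, μ⟩) j k‖ ^ 2)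
          + ((F.L : ℝ) ^ s)⁻¹ ^ 4 * (c₀ * ∑ y ∈ S', ∑ j : Fin 2, ∑ k : Fin 2, ‖((toL2S F K c₀).symm φ y) j k‖ ^ 2)) := by
  have h := localEnergy_gradComm_le_member F n K c₀ W Z ZE ζ s he hW hZ hZE S S' hζ1 hζ2 hζS hSS' φ
  refine h.trans ?_
  have hc : (0 : ℝ) < c₀ := Fact.out
  set G := c₀ * ∑ y ∈ S', ∑ μ : Fin (F.P K).d, ∑ j : Fin 2, ∑ k : Fin 2, ‖((toL2 F K c₀).symm (DL2 F n K c₀ W φ) ⟨y, μ⟩) j k‖ ^ 2 with hGdef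
  set Φ := c₀ * ∑ y ∈ S', ∑ j : Fin 2, ∑ k : Fin 2, ‖((toL2S F K c₀).symm φ y) j k‖ ^ 2 with hΦdef
  have hG : 0 ≤ G := by positivity
  have hΦ : 0 ≤ Φ := by positivity
  -- the radii: `r := (L^s)⁻¹ ∈ (0,1]`, `t := ℓ⁻¹ ∈ (0,1]`, window `e ≤ r²`
  set r : ℝ := ((F.L : ℝ) ^ s)⁻¹ with hr
  set t : ℝ := ((F.L : ℝ) ^ (K - n))⁻¹ with ht
  have hR1 : (1 : ℝ) ≤ (F.L : ℝ) ^ s := one_le_pow_L F s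
  have hℓ1 : (1 : ℝ) ≤ (F.L : ℝ) ^ (K - n) := one_le_pow_L F (K - n)
  have hr0 : 0 ≤ r := by positivity
  have hr1 : r ≤ 1 := inv_le_one_of_one_le₀ hR1
  have ht0 : 0 ≤ t := by positivity
  have ht1 : t ≤ 1 := inv_le_one_of_one_le₀ hℓ1
  have her : e ≤ r ^ 2 := by
    rw [hr, inv_pow, ← one_div]
    exact (le_div_iff₀ (by positivity)).mpr hew
  -- `e²·r²·t² ≤ r⁴`
  have he2 : e ^ 2 ≤ (r ^ 2) ^ 2 := pow_le_pow_left₀ he.le her 2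
  have ht2 : t ^ 2 ≤ 1 := pow_le_one₀ ht0 ht1
  have hr2 : r ^ 2 ≤ 1 := pow_le_one₀ hr0 hr1
  have hkey : e ^ 2 * r ^ 2 * t ^ 2 ≤ r ^ 4 := by
    calc e ^ 2 * r ^ 2 * t ^ 2 ≤ (r ^ 2) ^ 2 * 1 * 1 := by
          apply mul_le_mul (mul_le_mul he2 hr2 (sq_nonneg _) (by positivity)) ht2 (sq_nonneg _) (by positivity)
      _ = r ^ 4 := by ring
  nlinarith [mul_le_mul_of_nonneg_right hkey hΦ, hG, hΦ, mul_nonneg (sq_nonneg r) hG]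

end Member

/-! ## §4 The localisation hypothesis from the package's support row -/

section Support

variable (ζ : Site (F.P K) 0 → ℝ)

/-- ★ **THE LOCALISATION HYPOTHESIS FROM THE SUPPORT ROW**: if `ζ y ≠ 0` forces every coordinate of `y` within cyclic distance `< D` of `c` (✓`exists_cutoffPackage`'s support
row, `D = L^s·L^{K−n}`), then `ζ` is constant (indeed zero) on the 2-cell about every site OUTSIDE any `S` containing the cyclic cube of radius `D + 1` about `c`:
for `x ∉ S`, `ζ(x ± e_μ) = ζ(x)` and `ζ(x + e_μ + e_ν) = ζ(x + e_μ)`. [cite: Balaban1985BackgroundPropagators, (3.19) p.393, (3.100) pp.413–414] -/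
theorem cellConst_of_support (c : Site (F.P K) 0) {D : ℕ}
    (hsupp : ∀ x : Site (F.P K) 0, ζ x ≠ 0 → ∀ κ : Fin 3, min (x κ - c κ).val (c κ - x κ).val < D)
    (S : Finset (Site (F.P K) 0)) (hS : ∀ x : Site (F.P K) 0, (∀ κ : Fin 3, min (x κ - c κ).val (c κ - x κ).val < D + 2) → x ∈ S) :
    ∀ x : Site (F.P K) 0, x ∉ S → ∀ μ : Fin 3, ζ (x.shift μ) = ζ x ∧ ζ (x.unshift μ) = ζ x ∧ ∀ ν : Fin 3, ζ ((x.shift μ).shift ν) = ζ (x.shift μ) := by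
  intro x hx μ
  have hN : 1 < (F.P K).sitesPerDir 0 := by
    show 1 < 2 * F.L ^ (F.m + K - 0)
    have := Nat.one_le_pow (F.m + K - 0) F.L (by have := F.hL.2; omega)
    omega
  -- a far coordinate
  obtain ⟨κ, hκ⟩ : ∃ κ : Fin 3, D + 2 ≤ min (x κ - c κ).val (c κ - x κ).val := by
    by_contra h
    exact hx (hS x fun κ => not_le.mp fun h' => h ⟨κ, h'⟩)
  -- `ζ` vanishes wherever that coordinate is at cyclic distance `≥ D`
  have hzero : ∀ y : Site (F.P K) 0, D ≤ min (y κ - c κ).val (c κ - y κ).val → ζ y = 0 := by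
    intro y hy
    by_contra h
    exact absurd (hsupp y h κ) (not_lt.mpr hy)
  -- one lattice step moves that coordinate's distance by at most one
  have hstep : ∀ (y : Site (F.P K) 0) (μ' : Fin 3), min (y κ - c κ).val (c κ - y κ).val ≤ min ((y.shift μ') κ - c κ).val (c κ - (y.shift μ') κ).val + 1
      ∧ min (y κ - c κ).val (c κ - y κ).val ≤ min ((y.unshift μ') κ - c κ).val (c κ - (y.unshift μ') κ).val + 1 := by
    intro y μ'
    by_cases h : κ = μ'
    · subst h
      have e1 : (y.shift κ) κ = y κ + 1 := by simp [Site.shift]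
      have e2 : (y.unshift κ) κ = y κ - 1 := by simp [Site.unshift]
      rw [e1, e2]
      exact ⟨(dist_add_one_le hN (y κ) (c κ)).2, (dist_sub_one_le hN (y κ) (c κ)).2⟩
    · have e1 : (y.shift μ') κ = y κ := Function.update_of_ne h _ _
      have e2 : (y.unshift μ') κ = y κ := Function.update_of_ne h _ _
      rw [e1, e2]
      omega
  have h0 : ζ x = 0 := hzero x (by omega)
  have h1 : ζ (x.shift μ) = 0 := hzero _ (by have := (hstep x μ).1; omega)
  have h2 : ζ (x.unshift μ) = 0 := hzero _ (by have := (hstep x μ).2; omega)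
  refine ⟨by rw [h1, h0], by rw [h2, h0], fun ν => ?_⟩
  have h3 : ζ ((x.shift μ).shift ν) = 0 := hzero _ (by have := (hstep x μ).1; have := (hstep (x.shift μ) ν).1; omega)
  rw [h3, h1]

end Support

end Summit.QuantumFields.YangMills.Theorems.Prop7Lane2PatchCommutatorH1

end
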